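import Summits.BirchSwinnertonDyer.BirchSwinnertonDyer.Theses.DerivedKatoValuationDoor
import Summits.BirchSwinnertonDyer.BirchSwinnertonDyer.Theorems.DerivedKatoDoor.Negative.TSaturation
import Literature.NumberTheory.EllipticCurves.Kato2004.GeneratorChange
import Literature.NumberTheory.EllipticCurves.Kato2004.FineSelmerDualDescentLengthProofs
import Literature.NumberTheory.EllipticCurves.Kato2004.FineSelmerDualDescentLengthConverseProofs
import Literature.NumberTheory.EllipticCurves.Kato2004.IntegralH1FiniteProofs
import Literature.NumberTheory.EllipticCurves.KatoFineSelmerDualUniquenessProofs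
import Literature.NumberTheory.EllipticCurves.ZpExtensionUnitTwistProofs
import Literature.NumberTheory.EllipticCurves.KatoRankBoundProofs
import Literature.NumberTheory.EllipticCurves.IwasawaAlgebraCharIdealProofs
import HarnessLib

/-!
# Route `DerivedKatoValuationDoor`, crux `FineLengthLeOneOfAnalyticRankTwo` (stmt-BirchSwinnertonDyer-23259, X′):
# kernels of the LEAD's OUTPUT-line attempt, part 1 — transport of `ℓ_T(X₀)`, the CONVERSE split glue, and
# the vertical Euler-system output statement (V) versus `T`-semisimplicity (S1)

LEAD prover `bsd-line-dkd-p1` (g2), director-bsd S0 RULING «descent» duty (4); work file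
`Cruxes/FineLengthLeOneOfAnalyticRankTwo/Lines/output.lean` r1 (evidence on 23259). THEOREMS ONLY (no `def`,
no new named fact, no `sorry`); namespace `…Theorems.DerivedKatoValuationDoor`; `--supports
stmt-BirchSwinnertonDyer-23259`. Open hypotheses are DISPLAYED (conditional results credit nothing): route
items `KatoMainConjecturePrimeTOfDoor` (23260; only Kato's proved `≤` half of Conj. 12.10 at `(T)`, Thm.
12.5 (4), is ever used), `AdmissibleZetaClassExists` (23029), the named fact `Kato2004.thm12_4`, and the OPEN
statement (V) «`ℓ_T(𝐇¹/Λz₀) + 1 ≤ rank_{ℤ_p} H¹(ℤ[1/p], T_pW)` for every admissible `z₀`» — the `≤` half of the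
«`p`-adic BSD conjecture for Kato's zeta elements» (Kim 2022 Conj. 1.15 `cork Sel₀(ℚ,E[p^∞]) = ord_{XΛ}
char(𝐇¹_Iw/Λz^{Kato})`, Burns–Kurihara–Sano Conj. 4.9; its `≥` half is Kato's theorem, Kim Prop. 7.1 = BKS
Prop. 4.5), spelled out verbatim in the tree's currency (`rank H¹(ℤ[1/p],T_pW) = 1 + cork Sel₀` is the
Poitou–Tate dictionary, Kurihara–Pollack Lemma 1.4).

WHAT IS PROVED.
* §0 `fineSelmerDual_lengthAt_primeT_eq` — `ℓ_T(X₀(E/ℚ_∞))` is an invariant of `(W, p)`: independent of the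
  cyclotomic datum and the topological generator (`FineSelmerDualData.changeData` — Washington §13.2 — then
  `FineSelmerDualData.exists_linearEquiv`; all tree theorems).
* §1 `fineLength_le_one_of_noAdmissibleClassInTSq`, `fineLengthLeOne_of_derivedKatoDoor_of_facts` — the
  CONVERSE of the split glue `derivedKatoDoor_of_parts`: D-K₂ ⇒ X′ modulo {23260, 23029, `thm12_4`}; with the
  glue, 23259 ≡ 23024 modulo those three.
* §4 (V) versus S1 at every door cell, modulo {23260, `thm12_4`}: `zetaValuationLeStrictRank_of_fineTSemisimple`
  (S1 ⇒ (V)), `fineTSemisimple_of_zetaValuationLeStrictRank` ((V) ⇒ S1 — Kim 2022 Thm. 1.16 «Conj. 1.15 ⇒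
  m_i = 1» in the tree's currency), `fineLength_le_one_of_zetaValuationLeStrictRank_of_rank_le_two` and
  `fineLengthLeOne_of_zetaValuationLeStrictRank_of_rank_le_two_of_facts` (X′ ⟸ (V) ∧ S2 mod 23260, 23029): the
  would-be «output» line {(V), S2} is line `descent` {S1, S2} in Euler-system costume.
Part 2 (`…OutputColeman.lean`): the Coleman mechanism and the position of its open stub N2|door.
CONSEQUENCE (LEAD report 2026-08-28T22:16Z): no OUTPUT line for X′ — Euler systems give divisibility
(`v ≥ s`), not semisimplicity. BSD is not proved by any of this.

References: [Kato04] = [cite: Kato2004Asterisque, Thm. 12.4 (p. 221), Thm. 12.5 (4) (p. 222), Conj. 12.10 (p. 224), (14.14.1) (p. 243)];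
[Kim22] = [cite: Kim2022StructureSelmer, Conj. 1.15, Thm. 1.16, Prop. 7.1]; [BKS19] = [cite: BurnsKuriharaSano2019, Prop. 4.5, Conj. 4.9];
[KP07] = [cite: KuriharaPollack2007, Lemma 1.4]; [Wa97] = [cite: Washington1997, §13.2]; [Gr99] = [cite: GreenbergLNM1716, §1].
-/

-- D-0017: single-problem summit, so `Summit.BirchSwinnertonDyer.BirchSwinnertonDyer.…` repeats a
-- namespace BY DESIGN.
set_option linter.dupNamespace false

noncomputable section

namespace Summit.BirchSwinnertonDyer.BirchSwinnertonDyer.Theorems.DerivedKatoValuationDoor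

open Field
open Literature Literature.NumberTheory.GaloisRepresentations
open Literature.NumberTheory.EllipticCurves Literature.NumberTheory.EllipticCurves.IwasawaAlgebra
open Literature.NumberTheory.EllipticCurves.ModularForms
open Literature.NumberTheory.EllipticCurves.Kato2004
open Literature.NumberTheory.EllipticCurves.Kato2004.EulerSystemValues
open Summit.BirchSwinnertonDyer.BirchSwinnertonDyer.Theses.DerivedKatoValuationDoor
open Summit.BirchSwinnertonDyer.BirchSwinnertonDyer.Theorems

/-! ## §0 Transport: `ℓ_T(X₀(E/ℚ_∞))` does not depend on the cyclotomic datum or the generator -/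

/-- **`ℓ_T(X₀)` is an invariant of `(W, p)`**: for two cyclotomic `ℤ_p`-extension data `K, K₁` of `ℚ`
with topological generators `γ, γ₁`, the constructed dual fine Selmer groups
`(W.fineSelmerDualData K hγ).X` and `(W.fineSelmerDualData K₁ hγ₁).X` have the same length at `(T)`.
Both data are unit twists of the normalised pair `(κ₀, γ₀)`
(`exists_isCyclotomic_isTopGenerator_isCyclotomicVariable_holds`, `IsCyclotomic.exists_eq_unitTwist_holds`);
the change of datum/generator (`FineSelmerDualData.changeData`, Washington §13.2: `T ↦ (1+T)^u − 1` fixes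
`(T)`, `lengthAt_changeData_primeT_eq`) followed by uniqueness of the fine dual for a fixed key
(`FineSelmerDualData.exists_linearEquiv`). [cite: Washington1997, §13.2]
[cite: GreenbergLNM1716, §1 (after Conj. 1.3)] -/
theorem fineSelmerDual_lengthAt_primeT_eq (W : WeierstrassCurve ℚ) [W.IsElliptic] (p : ℕ) [Fact p.Prime]
    {K : ZpExtension ℚ p} (hK : K.IsCyclotomic) {γ : absoluteGaloisGroup ℚ} (hγ : K.IsTopGenerator γ)
    {K₁ : ZpExtension ℚ p} (hK₁ : K₁.IsCyclotomic) {γ₁ : absoluteGaloisGroup ℚ}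
    (hγ₁ : K₁.IsTopGenerator γ₁) :
    Module.lengthAt (IwasawaAlgebra p) (W.fineSelmerDualData K hγ).X (primeT p) =
      Module.lengthAt (IwasawaAlgebra p) (W.fineSelmerDualData K₁ hγ₁).X (primeT p) := by
  obtain ⟨κ₀, hκ₀, γ₀, hγ₀, -⟩ := exists_isCyclotomic_isTopGenerator_isCyclotomicVariable_holds p
  obtain ⟨c, rfl⟩ := ZpExtension.IsCyclotomic.exists_eq_unitTwist_holds (κ := κ₀) hκ₀ hK
  obtain ⟨c₁, rfl⟩ := ZpExtension.IsCyclotomic.exists_eq_unitTwist_holds (κ := κ₀) hκ₀ hK₁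
  have h := (W.fineSelmerDualData (κ₀.unitTwist c) hγ).lengthAt_changeData_primeT_eq κ₀ c hγ hγ₀
  have h₁ := (W.fineSelmerDualData (κ₀.unitTwist c₁) hγ₁).lengthAt_changeData_primeT_eq κ₀ c₁ hγ₁ hγ₀
  obtain ⟨e, -⟩ := ((W.fineSelmerDualData (κ₀.unitTwist c) hγ).changeData κ₀ c hγ hγ₀).exists_linearEquiv
    ((W.fineSelmerDualData (κ₀.unitTwist c₁) hγ₁).changeData κ₀ c₁ hγ₁ hγ₀)
  rw [← h, ← h₁]
  exact Module.lengthAt_eq_of_linearEquiv e (primeT p)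

/-! ## §1 From the parent's conclusion `Z₂(W,p)` down to the child `ℓ_T(X₀) ≤ 1` — the CONVERSE of the
split glue `derivedKatoDoor_of_parts`, modulo print -/

/-- **`Z₂(W,p)` (no admissible class of any cyclotomic pin at `(W,p)` is `T²`-divisible up to `p`-powers)
forces `ℓ_T(X₀(E/ℚ_∞)) ≤ 1` for EVERY cyclotomic datum at a door prime**, modulo the named facts
`Kato2004.thm12_4` (`𝐇¹` free of rank one ⇒ `T² ∤ z₀` rationally gives `ℓ_T(𝐇¹/Λz₀) ≤ 1`:
`derivedKatoDoor_quotientLength_le_one_of_not_TSq_smul`) and `kato_mainConjecture_primeT_of_door` (= route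
item 23260, Conj. 12.10 at `(T)`: `ℓ_T(X₀) = ℓ_T(𝐇¹/Λz₀)`; only Kato's PROVED half `≤`, Thm. 12.5 (4), is
used: `derivedKatoDoor_fineLength_le_quotientLength_of_mainConjecturePrimeT`), and ONE admissible class over
SOME cyclotomic datum at `(W,p)` (the conclusion of route item 23029); §0 moves the bound to every datum.
[cite: Kato2004Asterisque, Thm. 12.4 (3) (p. 221), Thm. 12.5 (4) (p. 222), Conj. 12.10 (p. 224)] -/
theorem fineLength_le_one_of_noAdmissibleClassInTSq (h124 : thm12_4)
    (hmc : kato_mainConjecture_primeT_of_door)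
    (W : WeierstrassCurve ℚ) [W.IsElliptic] [W.IsGloballyMinimal] (p : ℕ) [Fact p.Prime]
    [ContinuousSMul ℤ_[p] (W.tateModule p)]
    (hdoor : 5 ≤ p ∧ IsOrdinaryAt W p ∧ W.HasSurjectiveModNGaloisRep p)
    (hadm : ∃ (K : ZpExtension ℚ p) (hK : K.IsCyclotomic) (γ : absoluteGaloisGroup ℚ)
      (I : IwasawaH1Data W p K γ) (z₀ : I.H), K.IsTopGenerator γ ∧ IsAdmissibleZetaClass W p K hK I z₀)
    (hZ : ∀ (K : ZpExtension ℚ p) (hK : K.IsCyclotomic) (γ : absoluteGaloisGroup ℚ)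
      (I : IwasawaH1Data W p K γ) (z₀ : I.H), K.IsTopGenerator γ → IsAdmissibleZetaClass W p K hK I z₀ →
        ¬ ∃ (h : I.H) (m : ℕ),
          ((p : IwasawaAlgebra p) ^ m) • z₀ = ((PowerSeries.X : IwasawaAlgebra p) ^ 2) • h)
    {K : ZpExtension ℚ p} (hK : K.IsCyclotomic) {γ : absoluteGaloisGroup ℚ} (hγ : K.IsTopGenerator γ) :
    Module.lengthAt (IwasawaAlgebra p) (W.fineSelmerDualData K hγ).X (primeT p) ≤ 1 := by
  obtain ⟨K₁, hK₁, γ₁, I₁, z₀, hγ₁, hz⟩ := hadm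
  have hv := hZ K₁ hK₁ γ₁ I₁ z₀ hγ₁ hz
  have h1 := derivedKatoDoor_quotientLength_le_one_of_not_TSq_smul h124 W p hdoor K₁ hK₁ γ₁ I₁ z₀ hγ₁ hv
  have h2 := derivedKatoDoor_fineLength_le_quotientLength_of_mainConjecturePrimeT hmc W p hdoor K₁ hK₁ γ₁
    I₁ z₀ hγ₁ hz
  rw [fineSelmerDual_lengthAt_primeT_eq W p hK hγ hK₁ hγ₁]
  exact h2.trans h1

/-- **CONVERSE of the split glue (`DerivedKatoDoorGlueBy_holds` / `derivedKatoDoor_of_parts`): the PARENT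
crux `DerivedKatoDoor` gives the CHILD `FineLengthLeOneOfAnalyticRankTwo`, modulo the route items 23260
(`KatoMainConjecturePrimeTOfDoor`), 23029 (`AdmissibleZetaClassExists`) and the named fact
`Kato2004.thm12_4`** — so 23259 ≡ 23024 modulo {23260, 23029, thm12_4}. CONDITIONAL (credits nothing).
[cite: Kato2004Asterisque, Thm. 12.4 (3) (p. 221), Conj. 12.10 (p. 224)] -/
theorem fineLengthLeOne_of_derivedKatoDoor_of_facts (h124 : thm12_4) (hmc : KatoMainConjecturePrimeTOfDoor)
    (hAdm : AdmissibleZetaClassExists) (hD : DerivedKatoDoor) : FineLengthLeOneOfAnalyticRankTwo := by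
  intro W _ _ p _ _ ha hdoor K hK γ hγ
  exact fineLength_le_one_of_noAdmissibleClassInTSq h124 hmc W p hdoor (hAdm W p hdoor)
    (fun K₁ hK₁ γ₁ I₁ z₀ hγ₁ hz => hD W p ha hdoor K₁ hK₁ γ₁ I₁ z₀ hγ₁ hz) hK hγ

/-! ## §4 The VERTICAL Euler-system output statement (V) «`ℓ_T(𝐇¹/Λz₀) + 1 ≤ rank H¹(ℤ[1/p], T_pW)`»
(the `≤` half of the `p`-adic BSD conjecture for Kato's zeta elements, Kim 2022 Conj. 1.15 / BKS) versus
S1 (`T`-semisimplicity of `X₀(E/ℚ_∞)`): (V) ≡ S1 at every door cell, modulo {23260, thm12_4} -/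

/-- **X′ at a cell from (V) and S2** (modulo item 23260 and ONE admissible class at the cell):
`ℓ_T(X₀) = ℓ_T(𝐇¹/Λz₀) ≤ rank H¹(ℤ[1/p],T_pW) − 1 ≤ 1` over the datum of the admissible class, transported
to every datum by §0. CONDITIONAL (credits nothing).
[cite: Kim2022StructureSelmer, Conj. 1.15] [cite: Kato2004Asterisque, Conj. 12.10 (p. 224)] -/
theorem fineLength_le_one_of_zetaValuationLeStrictRank_of_rank_le_two
    (hmc : kato_mainConjecture_primeT_of_door)
    (W : WeierstrassCurve ℚ) [W.IsElliptic] [W.IsGloballyMinimal] (p : ℕ) [Fact p.Prime]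
    [ContinuousSMul ℤ_[p] (W.tateModule p)]
    (hdoor : 5 ≤ p ∧ IsOrdinaryAt W p ∧ W.HasSurjectiveModNGaloisRep p)
    (hadm : ∃ (K : ZpExtension ℚ p) (hK : K.IsCyclotomic) (γ : absoluteGaloisGroup ℚ)
      (I : IwasawaH1Data W p K γ) (z₀ : I.H), K.IsTopGenerator γ ∧ IsAdmissibleZetaClass W p K hK I z₀)
    (hO : ∀ (K : ZpExtension ℚ p) (hK : K.IsCyclotomic) (γ : absoluteGaloisGroup ℚ)
      (I : IwasawaH1Data W p K γ) (z₀ : I.H), K.IsTopGenerator γ → IsAdmissibleZetaClass W p K hK I z₀ →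
        Module.lengthAt (IwasawaAlgebra p) (I.H ⧸ Submodule.span (IwasawaAlgebra p) {z₀}) (primeT p) + 1 ≤
          Cardinal.toENat (Module.rank ℤ_[p] ↥(integralH1 (tateRep W p) p ⊤)))
    (hS2 : Module.rank ℤ_[p] ↥(integralH1 (tateRep W p) p ⊤) ≤ 2)
    {K : ZpExtension ℚ p} (hK : K.IsCyclotomic) {γ : absoluteGaloisGroup ℚ} (hγ : K.IsTopGenerator γ) :
    Module.lengthAt (IwasawaAlgebra p) (W.fineSelmerDualData K hγ).X (primeT p) ≤ 1 := by
  obtain ⟨K₁, hK₁, γ₁, I₁, z₀, hγ₁, hz⟩ := hadm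
  have hle := hO K₁ hK₁ γ₁ I₁ z₀ hγ₁ hz
  have h2 : Cardinal.toENat (Module.rank ℤ_[p] ↥(integralH1 (tateRep W p) p ⊤)) ≤ 2 :=
    Cardinal.toENat_le_ofNat.mpr hS2
  have hq : Module.lengthAt (IwasawaAlgebra p) (I₁.H ⧸ Submodule.span (IwasawaAlgebra p) {z₀}) (primeT p) ≤ 1 := by
    have h12 : (1 : ℕ∞) + Module.lengthAt (IwasawaAlgebra p) (I₁.H ⧸ Submodule.span (IwasawaAlgebra p) {z₀})
        (primeT p) ≤ 1 + 1 :=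
      calc (1 : ℕ∞) + Module.lengthAt (IwasawaAlgebra p) (I₁.H ⧸ Submodule.span (IwasawaAlgebra p) {z₀}) (primeT p)
          = Module.lengthAt (IwasawaAlgebra p) (I₁.H ⧸ Submodule.span (IwasawaAlgebra p) {z₀}) (primeT p) + 1 :=
            add_comm _ _
        _ ≤ Cardinal.toENat (Module.rank ℤ_[p] ↥(integralH1 (tateRep W p) p ⊤)) := hle
        _ ≤ 2 := h2
        _ = 1 + 1 := by norm_num
    exact (ENat.add_le_add_iff_left ENat.one_ne_top).mp h12
  have hX := derivedKatoDoor_fineLength_le_quotientLength_of_mainConjecturePrimeT hmc W p hdoor K₁ hK₁ γ₁ I₁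
    z₀ hγ₁ hz
  rw [fineSelmerDual_lengthAt_primeT_eq W p hK hγ hK₁ hγ₁]
  exact hX.trans hq

/-- **S1 ⟹ (V), at every door cell** (modulo item 23260 and `thm12_4`): for an admissible `z₀` over
`(K, γ, I)`, `ℓ_T(𝐇¹/Λz₀) = ℓ_T(𝐇²) = ℓ_T(X₀) = ℓ_T(X₀[T])` (S1) `≤ ℓ_T(𝐇²[T])`, and `rank = ℓ_T(A) =
ℓ_T(𝐇¹/T𝐇¹) + ℓ_T(𝐇²[T]) = 1 + ℓ_T(𝐇²[T])` (Kato (14.14.1), landed `lengthAt_A_eq_coinvariants_add_invariants`,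
`toENat_rank_integralH1_eq_lengthAt_A`; `𝐇¹` free of rank one). CONDITIONAL (credits nothing).
[cite: Kato2004Asterisque, §14.14 (14.14.1) (p. 243), Thm. 12.4 (3) (p. 221)]
[cite: Kim2022StructureSelmer, Conj. 1.15 and §7] -/
theorem zetaValuationLeStrictRank_of_fineTSemisimple (hmc : kato_mainConjecture_primeT_of_door)
    (h124 : thm12_4) (W : WeierstrassCurve ℚ) [W.IsElliptic] [W.IsGloballyMinimal] (p : ℕ) [Fact p.Prime]
    [ContinuousSMul ℤ_[p] (W.tateModule p)]
    (hdoor : 5 ≤ p ∧ IsOrdinaryAt W p ∧ W.HasSurjectiveModNGaloisRep p)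
    (hS1 : ∀ (K : ZpExtension ℚ p), K.IsCyclotomic → ∀ (γ : absoluteGaloisGroup ℚ) (hγ : K.IsTopGenerator γ),
      Module.lengthAt (IwasawaAlgebra p) ↥(TSubmodule p (W.fineSelmerDualData K hγ).X) (primeT p) = 0)
    (K : ZpExtension ℚ p) (hK : K.IsCyclotomic) (γ : absoluteGaloisGroup ℚ) (I : IwasawaH1Data W p K γ)
    (z₀ : I.H) (hγ : K.IsTopGenerator γ) (hz : IsAdmissibleZetaClass W p K hK I z₀) :
    Module.lengthAt (IwasawaAlgebra p) (I.H ⧸ Submodule.span (IwasawaAlgebra p) {z₀}) (primeT p) + 1 ≤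
      Cardinal.toENat (Module.rank ℤ_[p] ↥(integralH1 (tateRep W p) p ⊤)) := by
  have hp2 : p ≠ 2 := by have := hdoor.1; omega
  haveI : NeZero (p : ℚ) := ⟨Nat.cast_ne_zero.mpr (Fact.out : p.Prime).ne_zero⟩
  have hirr : W.HasIrreducibleModPGaloisRep p :=
    hasIrreducibleModPGaloisRep_of_hasSurjectiveModNGaloisRep W p hdoor.2.2
  obtain ⟨J, e, he, hfin, hlen⟩ := hmc W p hdoor.1 hdoor.2.1 hdoor.2.2 K hK γ hγ I
  -- `ℓ_T(𝐇¹/Λz₀) = ℓ_T(𝐇²) = ℓ_T(X₀)`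
  have hq : Module.lengthAt (IwasawaAlgebra p) (I.H ⧸ Submodule.span (IwasawaAlgebra p) {z₀}) (primeT p) =
      Module.lengthAt (IwasawaAlgebra p) (W.fineSelmerDualData K hγ).X (primeT p) := by
    rw [← hlen z₀ hz]
    exact (lengthAt_eq_of_injective_of_finite_quotient e he hfin _ (IwasawaAlgebra.height_primeT p).le).symm
  -- `ℓ_T(X₀) = ℓ_T(X₀[T])` (S1) `≤ ℓ_T(𝐇²[T])`
  have hX : Module.lengthAt (IwasawaAlgebra p) (W.fineSelmerDualData K hγ).X (primeT p) =
      Module.lengthAt (IwasawaAlgebra p) ↥(invariants p (W.fineSelmerDualData K hγ).X) (primeT p) := by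
    have h := lengthAt_eq_invariants_add_TSubmodule p (W.fineSelmerDualData K hγ).X
    rw [hS1 K hK γ hγ, add_zero] at h
    exact h
  have hXH : Module.lengthAt (IwasawaAlgebra p) ↥(invariants p (W.fineSelmerDualData K hγ).X) (primeT p) ≤
      Module.lengthAt (IwasawaAlgebra p) ↥(invariants p J.H2) (primeT p) :=
    IwasawaAlgebra.lengthAt_invariants_le_of_injective e he
  -- `rank = ℓ_T(A) = ℓ_T(𝐇¹/T𝐇¹) + ℓ_T(𝐇²[T])`, `ℓ_T(𝐇¹/T𝐇¹) = 1`
  obtain ⟨hfree, hrank⟩ := (h124 W p K γ hK hγ I).2.2 hp2 hirr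
  haveI := hfree
  have h1 : Module.lengthAt (IwasawaAlgebra p) (coinvariants p I.H) (primeT p) = 1 :=
    IwasawaAlgebra.lengthAt_coinvariants_eq_one_of_free_of_finrank_eq_one hrank
  have hA := J.lengthAt_A_eq_coinvariants_add_invariants
  have hr := J.toENat_rank_integralH1_eq_lengthAt_A
  calc Module.lengthAt (IwasawaAlgebra p) (I.H ⧸ Submodule.span (IwasawaAlgebra p) {z₀}) (primeT p) + 1
      = Module.lengthAt (IwasawaAlgebra p) ↥(invariants p (W.fineSelmerDualData K hγ).X) (primeT p) + 1 := by
        rw [hq, hX]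
    _ ≤ Module.lengthAt (IwasawaAlgebra p) ↥(invariants p J.H2) (primeT p) + 1 := add_le_add hXH le_rfl
    _ = Module.lengthAt (IwasawaAlgebra p) (coinvariants p I.H) (primeT p) +
          Module.lengthAt (IwasawaAlgebra p) ↥(invariants p J.H2) (primeT p) := by rw [h1, add_comm]
    _ = Module.lengthAt (IwasawaAlgebra p) J.A (primeT p) := hA.symm
    _ = Cardinal.toENat (Module.rank ℤ_[p] ↥(integralH1 (tateRep W p) p ⊤)) := hr.symm

/-- **(V) ⟹ S1, at every door cell** (Kim 2022 Thm. 1.16 «Conj. 1.15 ⇒ `m_i = 1`» in the tree's currency;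
modulo item 23260, `thm12_4` and ONE admissible class on the datum): `ℓ_T(X₀[T]) + ℓ_T(T·X₀) = ℓ_T(X₀) =
ℓ_T(𝐇¹/Λz₀) ≤ rank − 1 = ℓ_T(𝐇²[T]) ≤ ℓ_T(X₀[T])` (finite cokernel,
`lengthAt_invariants_le_of_injective_of_finite_coker`), and `rank < ∞` (`H¹(ℤ[1/p],T_pW)` is finitely generated,
tree theorem `module_finite_integralH1_top`), so `ℓ_T(T·X₀) = 0`. CONDITIONAL (credits nothing).
[cite: Kim2022StructureSelmer, Thm. 1.16 and §7] [cite: Kato2004Asterisque, §14.14 (14.14.1) (p. 243)] -/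
theorem fineTSemisimple_of_zetaValuationLeStrictRank (hmc : kato_mainConjecture_primeT_of_door)
    (h124 : thm12_4) (W : WeierstrassCurve ℚ) [W.IsElliptic] [W.IsGloballyMinimal] (p : ℕ) [Fact p.Prime]
    [ContinuousSMul ℤ_[p] (W.tateModule p)]
    (hdoor : 5 ≤ p ∧ IsOrdinaryAt W p ∧ W.HasSurjectiveModNGaloisRep p)
    (hO : ∀ (K : ZpExtension ℚ p) (hK : K.IsCyclotomic) (γ : absoluteGaloisGroup ℚ)
      (I : IwasawaH1Data W p K γ) (z₀ : I.H), K.IsTopGenerator γ → IsAdmissibleZetaClass W p K hK I z₀ →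
        Module.lengthAt (IwasawaAlgebra p) (I.H ⧸ Submodule.span (IwasawaAlgebra p) {z₀}) (primeT p) + 1 ≤
          Cardinal.toENat (Module.rank ℤ_[p] ↥(integralH1 (tateRep W p) p ⊤)))
    {K : ZpExtension ℚ p} (hK : K.IsCyclotomic) {γ : absoluteGaloisGroup ℚ} (hγ : K.IsTopGenerator γ)
    (hadm : ∃ (I : IwasawaH1Data W p K γ) (z₀ : I.H), IsAdmissibleZetaClass W p K hK I z₀) :
    Module.lengthAt (IwasawaAlgebra p) ↥(TSubmodule p (W.fineSelmerDualData K hγ).X) (primeT p) = 0 := by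
  have hp2 : p ≠ 2 := by have := hdoor.1; omega
  haveI : NeZero (p : ℚ) := ⟨Nat.cast_ne_zero.mpr (Fact.out : p.Prime).ne_zero⟩
  have hirr : W.HasIrreducibleModPGaloisRep p :=
    hasIrreducibleModPGaloisRep_of_hasSurjectiveModNGaloisRep W p hdoor.2.2
  obtain ⟨I, z₀, hz⟩ := hadm
  obtain ⟨J, e, he, hfin, hlen⟩ := hmc W p hdoor.1 hdoor.2.1 hdoor.2.2 K hK γ hγ I
  have hle := hO K hK γ I z₀ hγ hz
  -- abbreviations
  set ℓX := Module.lengthAt (IwasawaAlgebra p) (W.fineSelmerDualData K hγ).X (primeT p) with hℓX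
  set ℓXi := Module.lengthAt (IwasawaAlgebra p) ↥(invariants p (W.fineSelmerDualData K hγ).X) (primeT p)
    with hℓXi
  set ℓXt := Module.lengthAt (IwasawaAlgebra p) ↥(TSubmodule p (W.fineSelmerDualData K hγ).X) (primeT p)
    with hℓXt
  set ℓH2i := Module.lengthAt (IwasawaAlgebra p) ↥(invariants p J.H2) (primeT p) with hℓH2i
  set R := Cardinal.toENat (Module.rank ℤ_[p] ↥(integralH1 (tateRep W p) p ⊤)) with hR
  -- `ℓ_T(𝐇¹/Λz₀) = ℓ_T(X₀)`
  have hq : Module.lengthAt (IwasawaAlgebra p) (I.H ⧸ Submodule.span (IwasawaAlgebra p) {z₀}) (primeT p) = ℓX := by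
    rw [hℓX, ← hlen z₀ hz]
    exact (lengthAt_eq_of_injective_of_finite_quotient e he hfin _ (IwasawaAlgebra.height_primeT p).le).symm
  rw [hq] at hle
  -- `R = ℓ_T(A) = 1 + ℓ_T(𝐇²[T])`
  obtain ⟨hfree, hrank⟩ := (h124 W p K γ hK hγ I).2.2 hp2 hirr
  haveI := hfree
  have h1 : Module.lengthAt (IwasawaAlgebra p) (coinvariants p I.H) (primeT p) = 1 :=
    IwasawaAlgebra.lengthAt_coinvariants_eq_one_of_free_of_finrank_eq_one hrank
  have hRA : R = 1 + ℓH2i := by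
    rw [hR, J.toENat_rank_integralH1_eq_lengthAt_A, J.lengthAt_A_eq_coinvariants_add_invariants, h1]
  -- `ℓ_T(𝐇²[T]) ≤ ℓ_T(X₀[T])` (finite cokernel) and `ℓX = ℓXi + ℓXt`
  have hHX : ℓH2i ≤ ℓXi := IwasawaAlgebra.lengthAt_invariants_le_of_injective_of_finite_coker e he hfin
  have hsplit : ℓX = ℓXi + ℓXt := lengthAt_eq_invariants_add_TSubmodule p (W.fineSelmerDualData K hγ).X
  -- `R < ⊤`
  have hRfin : R ≠ ⊤ := by
    haveI : Module.Finite ℤ_[p] ↥(integralH1 (tateRep W p) p ⊤) := module_finite_integralH1_top W p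
    rw [hR, Ne, Cardinal.toENat_eq_top, not_le]
    exact Module.rank_lt_aleph0 _ _
  have hH2fin : ℓH2i ≠ ⊤ := by
    intro htop
    exact hRfin (by rw [hRA, htop, add_top])
  -- `ℓX + 1 ≤ R = 1 + ℓH2i` ⟹ `ℓX ≤ ℓH2i ≤ ℓXi`
  have h' : (1 : ℕ∞) + ℓX ≤ 1 + ℓH2i := by rw [add_comm (1 : ℕ∞) ℓX, ← hRA]; exact hle
  have hXH2 : ℓX ≤ ℓH2i := (ENat.add_le_add_iff_left ENat.one_ne_top).mp h'
  have hXle : ℓX ≤ ℓXi := hXH2.trans hHX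
  have hXifin : ℓXi ≠ ⊤ := by
    intro htop
    have : ℓX = ⊤ := by rw [hsplit, htop, top_add]
    exact hH2fin (top_le_iff.mp (this ▸ hXH2))
  -- conclude: `ℓXi + ℓXt ≤ ℓXi + 0` with `ℓXi ≠ ⊤`
  have hfinal : ℓXi + ℓXt ≤ ℓXi + 0 := by rw [add_zero, ← hsplit]; exact hXle
  exact nonpos_iff_eq_zero.mp ((ENat.add_le_add_iff_left hXifin).mp hfinal)

/-- **Hence line `descent` in Euler-system costume: X′ from (V), S2 and the route items 23260, 23029** (the
«output» line through the `p`-adic BSD conjecture for Kato's zeta elements IS `descent`'s reduction modulo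
print: (V) ≡ S1 by the two theorems above). CONDITIONAL (credits nothing).
[cite: Kim2022StructureSelmer, Conj. 1.15 and Thm. 1.16] -/
theorem fineLengthLeOne_of_zetaValuationLeStrictRank_of_rank_le_two_of_facts
    (hmc : KatoMainConjecturePrimeTOfDoor) (hAdm : AdmissibleZetaClassExists)
    (hV : ∀ (W : WeierstrassCurve ℚ) [W.IsElliptic] [W.IsGloballyMinimal] (p : ℕ) [Fact p.Prime]
      [ContinuousSMul ℤ_[p] (W.tateModule p)], W.analyticRank = 2 →
      (5 ≤ p ∧ IsOrdinaryAt W p ∧ W.HasSurjectiveModNGaloisRep p) →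
      ∀ (K : ZpExtension ℚ p) (hK : K.IsCyclotomic) (γ : absoluteGaloisGroup ℚ)
        (I : IwasawaH1Data W p K γ) (z₀ : I.H), K.IsTopGenerator γ → IsAdmissibleZetaClass W p K hK I z₀ →
          Module.lengthAt (IwasawaAlgebra p) (I.H ⧸ Submodule.span (IwasawaAlgebra p) {z₀}) (primeT p) + 1 ≤
            Cardinal.toENat (Module.rank ℤ_[p] ↥(integralH1 (tateRep W p) p ⊤)))
    (hS2 : ∀ (W : WeierstrassCurve ℚ) [W.IsElliptic] [W.IsGloballyMinimal] (p : ℕ) [Fact p.Prime]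
      [ContinuousSMul ℤ_[p] (W.tateModule p)], W.analyticRank = 2 →
      (5 ≤ p ∧ IsOrdinaryAt W p ∧ W.HasSurjectiveModNGaloisRep p) →
      Module.rank ℤ_[p] ↥(integralH1 (tateRep W p) p ⊤) ≤ 2) :
    FineLengthLeOneOfAnalyticRankTwo := by
  intro W _ _ p _ _ ha hdoor K hK γ hγ
  exact fineLength_le_one_of_zetaValuationLeStrictRank_of_rank_le_two hmc W p hdoor (hAdm W p hdoor)
    (hV W p ha hdoor) (hS2 W p ha hdoor) hK hγ


end Summit.BirchSwinnertonDyer.BirchSwinnertonDyer.Theorems.DerivedKatoValuationDoor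

end
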